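import Summits.BirchSwinnertonDyer.BirchSwinnertonDyer.Theorems.ByReductionTypeAtTwoMultTransportTwistedDescentSingle
import Summits.BirchSwinnertonDyer.BirchSwinnertonDyer.Theorems.ByReductionTypeAtTwoMultTransportTwistedDescentGenericProp49
import HarnessLib

/-!
# T-42 in the kernel, generic twisted descent (LXV-d): the ∀-wrappers of file `…TwistedDescentSingle` with a
# PREDICATE `R` in place of the threaded binder `W.HasMultiplicativeReductionAtPrime 2`

Cell `bsd-2adic` (run/shared/lean/pub/bsd-2adic/), seat `bsd-2adic-t42` (BRIEF-T42), GEN 29 (memo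
`t42/DESIGN-T42-ADDENDUM-33.md`, «F3a road»: Matsuno's Lemma 4.5 (i) at a GOOD ORDINARY `2` as a kernel theorem).
HONEST FRAMING: research route; THEOREMS ONLY (no `def`, no named fact, no instance); nothing booked; nothing re-keyed;
BSD is not proved by any of this. PARTITION: X5@2 GV-transport rows whose REFERENCE curve is GOOD ORDINARY at `2`
(K4ᵐ B1·O1 `MultCongruenceTransportAtTwo`; the binder `hF3a` of p744459) × p = 2 — types-the-object-of; bears_on K4 items
19922 / 19923 (`--supports stmt-BirchSwinnertonDyer-19923`).

## What

In files XIV–XXX of the multiplicative road (`hF3b`), the reduction hypothesis `W.HasMultiplicativeReductionAtPrime 2`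
of the ∀-statements `LIFT`, `LIFT₁`, `LIFT₂`, `LIFT₃`, `T2`, `δ2`, `δinf` and of the conclusion is only THREADED — it is
consumed by the two local inputs at the end of the chain (the Tate-line package at `2`), never by the wrappers. This file
re-lands the wrappers of `…TwistedDescentSingle` with an arbitrary predicate
`R : ∀ (W : WeierstrassCurve ℚ) [W.IsElliptic] [W.IsGloballyMinimal], Prop` in place of that binder (names suffixed
`_R`, `R` the first explicit argument; statements and proofs otherwise VERBATIM). Instantiated at
`R W := IsOrdinaryAt W 2` with the good-ordinary local inputs (`…TwistedDescentOrdLinePackage`, `…OrdT2Final`) the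
chain yields `Matsuno2008.lemma45i_noFiniteSubmodule_nonPrimitive_goodOrd_two` from Greenberg's Prop. 4.9; at
`R W := W.HasMultiplicativeReductionAtPrime 2` it is the original chain.

Declarations: `lift_of_liftSingle_R`, `hF3b_of_prop49_single_R`.

References: [GreenbergLNM1716] §4 Lemma 4.6, Prop. 4.9, Props. 4.13–4.15 (pp. 105–126); [GreenbergVatsal2000] §2 pp. 14–17;
[MilneADT2006] I Thm. 4.10, Cor. 2.3.
-/


set_option autoImplicit false
set_option linter.dupNamespace false

noncomputable section

open scoped Classical

universe u

namespace Summit.BirchSwinnertonDyer.BirchSwinnertonDyer.Theorems.MultTransportTwistedDescent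

open NumberField IsDedekindDomain Field WeierstrassCurve
  Literature.NumberTheory.EllipticCurves Literature.NumberTheory.EllipticCurves.GreenbergVatsal2000
  Literature.NumberTheory.EllipticCurves.Greenberg1999 Literature.NumberTheory.EllipticCurves.Matsuno2008
  Literature.NumberTheory.GaloisRepresentations
  Summit.BirchSwinnertonDyer.Rank1Residual.X5.O1
  Summit.BirchSwinnertonDyer.BirchSwinnertonDyer.Theorems.MultTransportAtTwo

/-- **`lift_of_liftSingle_R : LIFT₁ → LIFT`.** The generic lifting `LIFT` of files XV–XVIII (local conditions
at every `Γ_ℚ`-conjugate of the places above `2` and `∞`) follows from `LIFT₁`, the same statement with the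
conditions — in the hypotheses on `c` and in the conclusion on `c' − c` — imposed ONLY at the fixed
embeddings (no `∀ σ`): the bad set of `LIFT` is contained in the bad set of `LIFT₁`, u by u. At `v ∋ 2`
there is one place of `ℚ_∞` above `2` (tree `X1.LocalKerOverAtPConj.conjH1_mem_localKerOver_of_mem`,
`κ` cyclotomic); at a real `w`, §1 applied to `c` (hypothesis) and to the `ψ_u`-invariant `c'`.
[cite: GreenbergLNM1716, §4 pp. 106–109, 122–124] [cite: SerreLocalFields1979, Ch. IV §4 Prop. 17] -/
theorem lift_of_liftSingle_R (R : ∀ (W : WeierstrassCurve ℚ) [W.IsElliptic] [W.IsGloballyMinimal], Prop)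
    (LIFT₁ : ∀ (W : WeierstrassCurve ℚ) [W.IsElliptic] [W.IsGloballyMinimal],
      R W →
      ∀ (κ : ZpExtension ℚ 2) (_hκ : κ.IsCyclotomic) (γ : absoluteGaloisGroup ℚ)
        (_hγ : κ.IsTopGenerator γ) (S₀ : Finset (HeightOneSpectrum (𝓞 ℚ)))
        (_hne : S₀.Nonempty)
        (_hS₀ : ∀ v ∈ S₀, ((2 : ℕ) : 𝓞 ℚ) ∉ v.asIdeal)
        (_hbad : ∀ v : HeightOneSpectrum (𝓞 ℚ), v ∉ S₀ → ((2 : ℕ) : 𝓞 ℚ) ∉ v.asIdeal →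
          W.HasGoodReductionAt v)
        (D : W.SelmerDualData κ γ) [Module.Finite (IwasawaAlgebra 2) D.X], D.IsTorsion →
      {u : ℤ | (2 : ℤ) ∣ u - 1 ∧
        ¬ ∀ c ∈ unramifiedOutside κ.kerSubgroup (W.geomPrimaryTorsion 2) 2
            (↑S₀ : Set (HeightOneSpectrum (𝓞 ℚ))),
        (∀ v ∈ {v : HeightOneSpectrum (𝓞 ℚ) | ((2 : ℕ) : 𝓞 ℚ) ∈ v.asIdeal},
            u • W.conjH1 2 κ.kerSubgroup γ c - c ∈ W.localKerOver 2 κ.kerSubgroup (v.adicCompletion ℚ)) →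
        (∀ w : InfinitePlace ℚ,
            u • W.conjH1 2 κ.kerSubgroup γ c - c ∈ W.localKerOver 2 κ.kerSubgroup w.Completion) →
        ∃ c' ∈ unramifiedOutside κ.kerSubgroup (W.geomPrimaryTorsion 2) 2
            (↑S₀ : Set (HeightOneSpectrum (𝓞 ℚ))),
          u • W.conjH1 2 κ.kerSubgroup γ c' - c' = 0 ∧
          (∀ v ∈ {v : HeightOneSpectrum (𝓞 ℚ) | ((2 : ℕ) : 𝓞 ℚ) ∈ v.asIdeal},
              c' - c ∈ W.localKerOver 2 κ.kerSubgroup (v.adicCompletion ℚ)) ∧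
          (∀ w : InfinitePlace ℚ, c' - c ∈ W.localKerOver 2 κ.kerSubgroup w.Completion)}.Finite) :
    ∀ (W : WeierstrassCurve ℚ) [W.IsElliptic] [W.IsGloballyMinimal],
      R W →
      ∀ (κ : ZpExtension ℚ 2) (_hκ : κ.IsCyclotomic) (γ : absoluteGaloisGroup ℚ)
        (_hγ : κ.IsTopGenerator γ) (S₀ : Finset (HeightOneSpectrum (𝓞 ℚ)))
        (_hne : S₀.Nonempty)
        (_hS₀ : ∀ v ∈ S₀, ((2 : ℕ) : 𝓞 ℚ) ∉ v.asIdeal)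
        (_hbad : ∀ v : HeightOneSpectrum (𝓞 ℚ), v ∉ S₀ → ((2 : ℕ) : 𝓞 ℚ) ∉ v.asIdeal →
          W.HasGoodReductionAt v)
        (D : W.SelmerDualData κ γ) [Module.Finite (IwasawaAlgebra 2) D.X], D.IsTorsion →
      {u : ℤ | (2 : ℤ) ∣ u - 1 ∧
        ¬ ∀ c ∈ unramifiedOutside κ.kerSubgroup (W.geomPrimaryTorsion 2) 2
            (↑S₀ : Set (HeightOneSpectrum (𝓞 ℚ))),
        (∀ v ∈ {v : HeightOneSpectrum (𝓞 ℚ) | ((2 : ℕ) : 𝓞 ℚ) ∈ v.asIdeal}, ∀ σ : absoluteGaloisGroup ℚ,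
            W.conjH1 2 κ.kerSubgroup σ (u • W.conjH1 2 κ.kerSubgroup γ c - c) ∈
              W.localKerOver 2 κ.kerSubgroup (v.adicCompletion ℚ)) →
        (∀ (w : InfinitePlace ℚ) (σ : absoluteGaloisGroup ℚ),
            W.conjH1 2 κ.kerSubgroup σ (u • W.conjH1 2 κ.kerSubgroup γ c - c) ∈
              W.localKerOver 2 κ.kerSubgroup w.Completion) →
        ∃ c' ∈ unramifiedOutside κ.kerSubgroup (W.geomPrimaryTorsion 2) 2
            (↑S₀ : Set (HeightOneSpectrum (𝓞 ℚ))),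
          u • W.conjH1 2 κ.kerSubgroup γ c' - c' = 0 ∧
          (∀ v ∈ {v : HeightOneSpectrum (𝓞 ℚ) | ((2 : ℕ) : 𝓞 ℚ) ∈ v.asIdeal},
            ∀ σ : absoluteGaloisGroup ℚ,
              W.conjH1 2 κ.kerSubgroup σ (c' - c) ∈ W.localKerOver 2 κ.kerSubgroup (v.adicCompletion ℚ)) ∧
          (∀ (w : InfinitePlace ℚ) (σ : absoluteGaloisGroup ℚ),
              W.conjH1 2 κ.kerSubgroup σ (c' - c) ∈ W.localKerOver 2 κ.kerSubgroup w.Completion)}.Finite := by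
  intro W _ _ hW κ hκ γ hγ S₀ hne hS₀ hbad D _ hD
  refine (LIFT₁ W hW κ hκ γ hγ S₀ hne hS₀ hbad D hD).subset ?_
  rintro u ⟨hu, hfail⟩
  refine ⟨hu, fun hgood ↦ hfail ?_⟩
  intro c hcH h2 hinf
  have hone : W.conjH1 2 κ.kerSubgroup 1 = AddMonoidHom.id _ := W.conjH1_one_holds 2 κ.kerSubgroup
  obtain ⟨c', hc'H, hψ, h2', hinf'⟩ := hgood c hcH
    (fun v hv ↦ by simpa only [hone, AddMonoidHom.id_apply] using h2 v hv 1)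
    (fun w ↦ by simpa only [hone, AddMonoidHom.id_apply] using hinf w 1)
  refine ⟨c', hc'H, hψ, fun v hv σ ↦ ?_, fun w σ ↦ ?_⟩
  · exact Summit.BirchSwinnertonDyer.Rank1Residual.X1.LocalKerOverAtPConj.conjH1_mem_localKerOver_of_mem
      2 κ W hκ hv (h2' v hv) σ
  · exact conjH1_sub_mem_localKerOver_infinitePlace_of_forall_twist W κ hγ w u c c' (hinf w)
      (fun τ ↦ by rw [hψ, map_zero]; exact zero_mem _) (hinf' w) σ

/-- **`hF3b` (VERBATIM, the binder of `MultTransportAtTwo.multCongruenceTransportAtTwo_of_corePrint_all`)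
from Greenberg's Prop. 4.9 BY NAME (`Greenberg1999.prop49_noFiniteSubmodule_H1Sigma`) plus the
single-embedding generic lifting `LIFT₁`** (for a multiplicative `2`, `κ` cyclotomic, `γ` a topological
generator, `Σ₀ ≠ ∅` odd containing the odd bad places, `X₂(E/ℚ_∞)` f.g. torsion: for all but finitely many
odd `u`, every `c ∈ H¹(ℚ_Σ/ℚ_∞, E[2^∞])` with `u·conj_γ c − c` Kummer at the CHOSEN place above `2` and at
the CHOSEN real place lifts to a `ψ_u`-invariant `c'` with `c' − c` Kummer at those two places;
Greenberg pp. 122–124): file XVIII `hF3b_of_prop49_R` composed with `lift_of_liftSingle_R`.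
[cite: GreenbergLNM1716, §4 Prop. 4.9 (p. 113), pp. 106–109, 122–125] -/
theorem hF3b_of_prop49_single_R (R : ∀ (W : WeierstrassCurve ℚ) [W.IsElliptic] [W.IsGloballyMinimal], Prop) (h49 : prop49_noFiniteSubmodule_H1Sigma)
    (LIFT₁ : ∀ (W : WeierstrassCurve ℚ) [W.IsElliptic] [W.IsGloballyMinimal],
      R W →
      ∀ (κ : ZpExtension ℚ 2) (_hκ : κ.IsCyclotomic) (γ : absoluteGaloisGroup ℚ)
        (_hγ : κ.IsTopGenerator γ) (S₀ : Finset (HeightOneSpectrum (𝓞 ℚ)))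
        (_hne : S₀.Nonempty)
        (_hS₀ : ∀ v ∈ S₀, ((2 : ℕ) : 𝓞 ℚ) ∉ v.asIdeal)
        (_hbad : ∀ v : HeightOneSpectrum (𝓞 ℚ), v ∉ S₀ → ((2 : ℕ) : 𝓞 ℚ) ∉ v.asIdeal →
          W.HasGoodReductionAt v)
        (D : W.SelmerDualData κ γ) [Module.Finite (IwasawaAlgebra 2) D.X], D.IsTorsion →
      {u : ℤ | (2 : ℤ) ∣ u - 1 ∧
        ¬ ∀ c ∈ unramifiedOutside κ.kerSubgroup (W.geomPrimaryTorsion 2) 2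
            (↑S₀ : Set (HeightOneSpectrum (𝓞 ℚ))),
        (∀ v ∈ {v : HeightOneSpectrum (𝓞 ℚ) | ((2 : ℕ) : 𝓞 ℚ) ∈ v.asIdeal},
            u • W.conjH1 2 κ.kerSubgroup γ c - c ∈ W.localKerOver 2 κ.kerSubgroup (v.adicCompletion ℚ)) →
        (∀ w : InfinitePlace ℚ,
            u • W.conjH1 2 κ.kerSubgroup γ c - c ∈ W.localKerOver 2 κ.kerSubgroup w.Completion) →
        ∃ c' ∈ unramifiedOutside κ.kerSubgroup (W.geomPrimaryTorsion 2) 2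
            (↑S₀ : Set (HeightOneSpectrum (𝓞 ℚ))),
          u • W.conjH1 2 κ.kerSubgroup γ c' - c' = 0 ∧
          (∀ v ∈ {v : HeightOneSpectrum (𝓞 ℚ) | ((2 : ℕ) : 𝓞 ℚ) ∈ v.asIdeal},
              c' - c ∈ W.localKerOver 2 κ.kerSubgroup (v.adicCompletion ℚ)) ∧
          (∀ w : InfinitePlace ℚ, c' - c ∈ W.localKerOver 2 κ.kerSubgroup w.Completion)}.Finite) :
    ∀ (W : WeierstrassCurve ℚ) [W.IsElliptic] [W.IsGloballyMinimal],
      R W →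
      ∀ (κ : ZpExtension ℚ 2) (_hκ : κ.IsCyclotomic) (γ : absoluteGaloisGroup ℚ)
        (_hγ : κ.IsTopGenerator γ) (S₀ : Finset (HeightOneSpectrum (𝓞 ℚ)))
        (_hne : S₀.Nonempty)
        (_hS₀ : ∀ v ∈ S₀, ((2 : ℕ) : 𝓞 ℚ) ∉ v.asIdeal)
        (_hbad : ∀ v : HeightOneSpectrum (𝓞 ℚ), v ∉ S₀ → ((2 : ℕ) : 𝓞 ℚ) ∉ v.asIdeal →
          W.HasGoodReductionAt v)
        (D : W.SelmerDualData κ γ) [Module.Finite (IwasawaAlgebra 2) D.X], D.IsTorsion →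
        ∀ (DS : NonPrimitiveDualData W κ γ (↑S₀ : Set (HeightOneSpectrum (𝓞 ℚ))))
          (N : Submodule (IwasawaAlgebra 2) DS.X), Finite N → N = ⊥ :=
  (hF3b_of_prop49_R (R := R)) h49 ((lift_of_liftSingle_R (R := R)) LIFT₁)

end Summit.BirchSwinnertonDyer.BirchSwinnertonDyer.Theorems.MultTransportTwistedDescent

end
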